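import Mathlib
import Summits.Ventures.PercRepro2.TypedPendant

/-!
# Typed-base reductions III: parallel edges (blind cell PercRepro2, night-3 g2, 2026-08-24;
rule (b) of `proofs/LEAD-TYPED-REDUCTION.md` §1, kernel-checked)

* **`typedCount_parallel`** (rule (b)): two parallel typed edges `e ≠ f` (`ends e = ends f`) of
  mixed types merge into the single typed edge `e`, `f` pinned closed, with the nonnegative
  integer multiplicities `muOr` (`#{(X, Y) ⊆ {1,2,3} : |X| = τ e, |Y| = τ f, X ∪ Y = Z}`):
  `N_τ = Σ_{j ≤ 3} muOr (τ e) (τ f) j · N_{τ[e := j]}(f closed)` — the open adjacency of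
  `x[e ↦ p][f ↦ a]` is that of `x[f ↦ closed][e ↦ p ∨ a]` (`openAdj_parallel`, `conn_parallel`,
  `st_parallel`), and the finite identity `sum_bool3_parallel` groups the copy-sets by their union;
  `muOr_zero`: for mixed types the merged edge never has type `0`. The reducible class built on
  this rule is `RedM` (`TypedContract.lean`).
-/

namespace Summit.Ventures.PercRepro2

namespace CovForm

namespace TypedRed

open OneTyped

/-! ## Parallel typed edges (rule (b)) -/

section Parallel

variable {V : Type*} {E : Type*} [DecidableEq E]

/-- The multiplicities of rule (b): `muOr a b j = #{(X, Y) : |X| = a, |Y| = b, X ∪ Y = Z}` for a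
fixed `Z ⊆ {1,2,3}` with `|Z| = j`, for the mixed types `a, b ∈ {1, 2}` (`0` elsewhere). -/
def muOr : ℕ → ℕ → ℕ → ℕ
  | 1, 1, 1 => 1
  | 1, 1, 2 => 2
  | 1, 2, 2 => 2
  | 1, 2, 3 => 3
  | 2, 1, 2 => 2
  | 2, 1, 3 => 3
  | 2, 2, 2 => 1
  | 2, 2, 3 => 6
  | _, _, _ => 0

/-- For mixed types the merged edge never has type `0`. -/
lemma muOr_zero (k l : ℕ) (hk : k = 1 ∨ k = 2) (hl : l = 1 ∨ l = 2) : muOr k l 0 = 0 := by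
  rcases hk with rfl | rfl <;> rcases hl with rfl | rfl <;> rfl

/-- Parallel edges: the open adjacency of `x[e ↦ p][f ↦ a]` is that of `x[f ↦ closed][e ↦ p ∨ a]`. -/
lemma openAdj_parallel {ends : E → Sym2 V} {e f : E} (hef : e ≠ f) (hpar : ends e = ends f)
    (x : Config E) (p a : Bool) (u v : V) :
    OpenAdj ends (Function.update (Function.update x e p) f a) u v ↔
      OpenAdj ends (Function.update (Function.update x f false) e (p || a)) u v := by
  constructor
  · rintro ⟨g, hg, hends⟩
    by_cases hgf : g = f
    · subst hgf
      rw [Function.update_self] at hg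
      refine ⟨e, ?_, hpar.trans hends⟩
      rw [Function.update_self, hg, Bool.or_true]
    · by_cases hge : g = e
      · subst hge
        rw [Function.update_of_ne hgf, Function.update_self] at hg
        refine ⟨g, ?_, hends⟩
        rw [Function.update_self, hg, Bool.true_or]
      · rw [Function.update_of_ne hgf, Function.update_of_ne hge] at hg
        refine ⟨g, ?_, hends⟩
        rw [Function.update_of_ne hge, Function.update_of_ne hgf]
        exact hg
  · rintro ⟨g, hg, hends⟩
    by_cases hge : g = e
    · subst hge
      rw [Function.update_self] at hg
      rcases Bool.or_eq_true_iff.1 hg with hp | ha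
      · refine ⟨g, ?_, hends⟩
        rw [Function.update_of_ne hef, Function.update_self]
        exact hp
      · refine ⟨f, ?_, hpar.symm.trans hends⟩
        rw [Function.update_self]
        exact ha
    · by_cases hgf : g = f
      · subst hgf
        rw [Function.update_of_ne hge, Function.update_self] at hg
        exact absurd hg Bool.false_ne_true
      · rw [Function.update_of_ne hge, Function.update_of_ne hgf] at hg
        refine ⟨g, ?_, hends⟩
        rw [Function.update_of_ne hgf, Function.update_of_ne hge]
        exact hg

/-- Parallel edges: connections in `x[e ↦ p][f ↦ a]` are those of `x[f ↦ closed][e ↦ p ∨ a]`. -/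
lemma conn_parallel {ends : E → Sym2 V} {e f : E} (hef : e ≠ f) (hpar : ends e = ends f)
    (x : Config E) (p a : Bool) (u v : V) :
    Conn ends (Function.update (Function.update x e p) f a) u v ↔
      Conn ends (Function.update (Function.update x f false) e (p || a)) u v := by
  have hadj : OpenAdj ends (Function.update (Function.update x e p) f a) =
      OpenAdj ends (Function.update (Function.update x f false) e (p || a)) := by
    funext u v
    exact propext (openAdj_parallel hef hpar x p a u v)
  unfold Conn openGraph
  rw [hadj]

variable [Fintype E] {R : Type*} [Field R]

omit [Fintype E] in
/-- Parallel edges: the state of `x[e ↦ p][f ↦ a]` is that of `x[f ↦ closed][e ↦ p ∨ a]`. -/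
lemma st_parallel (ends : E → Sym2 V) (o a₁ a₂ a₃ b : V) {e f : E} (hef : e ≠ f)
    (hpar : ends e = ends f) (x : Config E) (p a : Bool) :
    st ends o a₁ a₂ a₃ b (Function.update (Function.update x e p) f a) =
      st ends o a₁ a₂ a₃ b (Function.update (Function.update x f false) e (p || a)) := by
  have key := conn_parallel hef hpar x p a
  unfold st
  simp only [Prod.mk.injEq]
  exact ⟨decide_eq_decide.mpr (key _ _), decide_eq_decide.mpr (key _ _),
    decide_eq_decide.mpr (key _ _), decide_eq_decide.mpr (key _ _),
    decide_eq_decide.mpr (key _ _), decide_eq_decide.mpr (key _ _),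
    decide_eq_decide.mpr (key _ _)⟩

/-- The finite identity behind rule (b): the `(X, Y) ↦ X ∪ Y` grouping of the copy-sets. -/
lemma sum_bool3_parallel (k l : ℕ) (hk : k = 1 ∨ k = 2) (hl : l = 1 ∨ l = 2)
    (T : Bool → Bool → Bool → R) :
    (∑ a : Bool, ∑ b : Bool, ∑ c : Bool, if a.toNat + b.toNat + c.toNat = l then
        (∑ p : Bool, ∑ q : Bool, ∑ r : Bool, if p.toNat + q.toNat + r.toNat = k then
          T (p || a) (q || b) (r || c) else 0) else 0) =
      ∑ j ∈ Finset.range 4, (muOr k l j : R) *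
        ∑ p : Bool, ∑ q : Bool, ∑ r : Bool, if p.toNat + q.toNat + r.toNat = j then T p q r else 0 := by
  rcases hk with rfl | rfl <;> rcases hl with rfl | rfl <;>
    simp [Finset.sum_range_succ, muOr] <;> ring

/-- **Parallel typed edges (rule (b))**: two parallel typed edges `e, f` of mixed types merge into
the single typed edge `e` (`f` pinned closed) with the multiplicities `muOr`:
`N_τ = Σ_j muOr(τ e, τ f, j) · N_{τ[e := j]}(f closed)`. -/
theorem typedCount_parallel (ends : E → Sym2 V) (o a₁ a₂ a₃ b : V) {e f : E} (hef : e ≠ f)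
    (hpar : ends e = ends f) (F : Finset E) (heF : e ∈ F) (hfF : f ∈ F) (z : Config E)
    (τ : E → ℕ) (hτe : τ e = 1 ∨ τ e = 2) (hτf : τ f = 1 ∨ τ f = 2) :
    typedCount F z τ (K3 ends o a₁ a₂ a₃ b : Config E → Config E → Config E → R) =
      ∑ j ∈ Finset.range 4, (muOr (τ e) (τ f) j : R) *
        typedCount (F.erase f) (Function.update z f false) (Function.update τ e j)
          (K3 ends o a₁ a₂ a₃ b) := by
  have heF' : e ∈ F.erase f := Finset.mem_erase.2 ⟨hef, heF⟩
  have hfF'' : f ∉ (F.erase f).erase e := fun h => (Finset.mem_erase.1 (Finset.mem_erase.1 h).2).1 rfl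
  have hz'' : Function.update (Function.update z f false) e false f = false := by
    rw [Function.update_of_ne (Ne.symm hef), Function.update_self]
  set T : Bool → Bool → Bool → R := fun p q r =>
    typedCount ((F.erase f).erase e) (Function.update (Function.update z f false) e false) τ
      (fun x y w => K3 ends o a₁ a₂ a₃ b (Function.update x e p) (Function.update y e q)
        (Function.update w e r)) with hT
  have hL : typedCount F z τ (K3 ends o a₁ a₂ a₃ b : Config E → Config E → Config E → R) =
      ∑ a : Bool, ∑ b' : Bool, ∑ c : Bool, if a.toNat + b'.toNat + c.toNat = τ f then
        (∑ p : Bool, ∑ q : Bool, ∑ r : Bool, if p.toNat + q.toNat + r.toNat = τ e then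
          T (p || a) (q || b') (r || c) else 0) else 0 := by
    rw [typedCount_split F f hfF]
    refine Finset.sum_congr rfl fun a _ => Finset.sum_congr rfl fun b' _ =>
      Finset.sum_congr rfl fun c _ => ?_
    refine if_congr Iff.rfl ?_ rfl
    rw [typedCount_split (F.erase f) e heF']
    refine Finset.sum_congr rfl fun p _ => Finset.sum_congr rfl fun q _ =>
      Finset.sum_congr rfl fun r _ => ?_
    refine if_congr Iff.rfl ?_ rfl
    rw [hT]
    simp only
    rw [← typedCount_update_pinned ((F.erase f).erase e) f hfF'' _ τ
      (fun x y w => K3 ends o a₁ a₂ a₃ b (Function.update x e (p || a))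
        (Function.update y e (q || b')) (Function.update w e (r || c))) false hz'']
    refine typedCount_congr_K _ _ _ fun x y w => ?_
    rw [K3_eq_KB, K3_eq_KB, st_parallel ends o a₁ a₂ a₃ b hef hpar x p a,
      st_parallel ends o a₁ a₂ a₃ b hef hpar y q b', st_parallel ends o a₁ a₂ a₃ b hef hpar w r c]
  have hR : ∀ j : ℕ, typedCount (F.erase f) (Function.update z f false) (Function.update τ e j)
      (K3 ends o a₁ a₂ a₃ b : Config E → Config E → Config E → R) =
      ∑ p : Bool, ∑ q : Bool, ∑ r : Bool, if p.toNat + q.toNat + r.toNat = j then T p q r else 0 := by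
    intro j
    rw [typedCount_split (F.erase f) e heF']
    refine Finset.sum_congr rfl fun p _ => Finset.sum_congr rfl fun q _ =>
      Finset.sum_congr rfl fun r _ => ?_
    rw [Function.update_self]
    refine if_congr Iff.rfl ?_ rfl
    rw [hT]
    simp only
    refine typedCount_congr_τ _ _ (fun e' he' => ?_) _
    rw [Function.update_of_ne (Finset.ne_of_mem_erase he')]
  rw [hL]
  simp only [hR]
  exact sum_bool3_parallel (τ e) (τ f) hτe hτf T

end Parallel

end TypedRed

end CovForm

end Summit.Ventures.PercRepro2
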